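import Summits.NavierStokesRegularity.NavierStokesRegularity.Theorems.LimitTransfer.Negative.WallPrice
import Summits.NavierStokesRegularity.NavierStokesRegularity.Theorems.AngularGalerkinLadderLimitTransfer

/-!
# KJ-31 — the wall price of route `AngularGalerkinLadder` AFTER the closure of K3 `LimitTransfer`

Refuter bookkeeping (ns-blowup refuter lineage, plain Negative lane, `--supports` item
stmt-NavierStokesRegularity-19960 `NoOverheating`; no definition, no positive route statement).

K3 `LimitTransfer` (item 19961) is now a THEOREM of the tree
(`Theorems.angularGalerkinLadder_limitTransfer`, p493315: lean g11's reduction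
`angularGalerkinLadder_limitTransfer_of_remainder'` applied to the Koch–Nadirashvili–Seregin–Šverák
forced Oseen-mild remainder bound `Literature.Analysis.FluidPDE.forcedOseenMild_remainder_typeI`,
p492811). The price sheet `WallPrice.lean` (KJ-17, p467395) was written while K3 was open; this file
specialises it to the post-closure state, kernel-checked:

* `not_typeIDSSLiouvilleConjecture_of_windows` — ONE admissible window sequence (constants `1 < cmin`,
  `0 < δ`, defect sizes `ε_n → 0`, a window rung profile at every index) now REFUTES the Type-I
  rotated-DSS Liouville conjecture (Bradshaw–Tsai 2017, §5, Open Problem 5.1) outright — before the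
  closure this needed K3 as a hypothesis (`not_limitTransfer_iff_conjecture_of_windows`);
* `not_typeIDSSLiouvilleConjecture_of_cofinal_of_noOverheating` — the two OPEN cruxes K1
  `RungBlowupCofinal` (19959) and K2 `NoOverheating` (19960) together refute the conjecture;
* the refutation prices of the open items, as `ledger negatives` entries:
  `noOverheating_false_of_typeIDSSLiouvilleConjecture_of_cofinal : TypeIDSSLiouvilleConjecture →
  RungBlowupCofinal → ¬ NoOverheating` and `rungBlowupCofinal_false_of_typeIDSSLiouvilleConjecture_of_noOverheating :
  TypeIDSSLiouvilleConjecture → NoOverheating → ¬ RungBlowupCofinal` — i.e. ¬K2 as typed costs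
  (Open Problem 5.1 affirmative) ∧ K1, and ¬K1 by this road costs (Open Problem 5.1 affirmative) ∧ K2
  (the direct road to ¬K1 is an eventual Liouville theorem for Type-I rotated-DSS ancient profiles of
  the truncated systems NS_L, not in print: KJ-17);
* `no_windows_of_typeIDSSLiouvilleConjecture` — contrapositive for planners: in a Liouville world NO
  admissible window sequence exists at all, whatever `C₀`, `[cmin, cmax]`, `δ` (parameter blindness
  survives the closure).

LABEL: KERNEL (pure logic over accepted theorems). WHAT THIS IS NOT: not NS — no profile, window or
rung solution is constructed or excluded; no item changes verdict; the conjecture is OPEN.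
References: [cite: BradshawTsai2017CPDE, §5 Open Problem 5.1];
[cite: KochNadirashviliSereginSverak2009, Lemma 3.1, Thm 6.1].
-/

namespace Summit.NavierStokesRegularity.AngularGalerkinLadderWallPriceAfterK3

open Filter Topology
open Literature.Analysis.FluidPDE hiding TypeIDSSLiouvilleConjecture
open Summit.NavierStokesRegularity.FluidComputer
open Summit.NavierStokesRegularity.NavierStokesRegularity
open Summit.NavierStokesRegularity.NavierStokesRegularity.Theses.AngularGalerkinLadder
open Summit.NavierStokesRegularity.AngularGalerkinLadderWallPrice

/-- **One admissible window sequence refutes the wall.** After the closure of K3 (p493315), the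
existence of a single admissible window sequence of the angular Galerkin ladder — constants
`1 < cmin`, `0 < δ`, defect sizes `ε_n → 0`, a window rung profile at every index, ANY Type-I constant
`C₀`, ANY factor window, ANY symmetry — refutes the Type-I rotated-DSS Liouville conjecture
(Bradshaw–Tsai 2017, Open Problem 5.1). [cite: BradshawTsai2017CPDE, §5 Open Problem 5.1] -/
theorem not_typeIDSSLiouvilleConjecture_of_windows
    (hwin : ∃ (C₀ cmin cmax δ : ℝ) (L : ℕ → ℕ) (ε c : ℕ → ℝ)
      (R : ℕ → (EuclideanSpace ℝ (Fin 3) ≃ₗᵢ[ℝ] EuclideanSpace ℝ (Fin 3)))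
      (u : ℕ → ℝ → EuclideanSpace ℝ (Fin 3) → EuclideanSpace ℝ (Fin 3))
      (p : ℕ → ℝ → EuclideanSpace ℝ (Fin 3) → ℝ)
      (d : ℕ → ℝ → EuclideanSpace ℝ (Fin 3) → EuclideanSpace ℝ (Fin 3)),
      1 < cmin ∧ 0 < δ ∧ Tendsto ε atTop (𝓝 0) ∧
        ∀ n, AngularLadder.IsWindowProfile (L n) C₀ cmin cmax δ (ε n) (c n) (R n) (u n) (p n)
          (d n)) :
    ¬ TypeIDSSLiouvilleConjecture :=
  fun hW => not_limitTransfer_of hW hwin Theorems.angularGalerkinLadder_limitTransfer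

/-- Contrapositive for planners: in a world where the Type-I rotated-DSS Liouville conjecture holds,
NO admissible window sequence of the angular Galerkin ladder exists — for no choice of the Type-I
constant, the factor window, the amplitude floor or the symmetry class (parameter blindness survives
the closure of K3). [cite: BradshawTsai2017CPDE, §5 Open Problem 5.1] -/
theorem no_windows_of_typeIDSSLiouvilleConjecture (hW : TypeIDSSLiouvilleConjecture) :
    ¬ ∃ (C₀ cmin cmax δ : ℝ) (L : ℕ → ℕ) (ε c : ℕ → ℝ)
      (R : ℕ → (EuclideanSpace ℝ (Fin 3) ≃ₗᵢ[ℝ] EuclideanSpace ℝ (Fin 3)))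
      (u : ℕ → ℝ → EuclideanSpace ℝ (Fin 3) → EuclideanSpace ℝ (Fin 3))
      (p : ℕ → ℝ → EuclideanSpace ℝ (Fin 3) → ℝ)
      (d : ℕ → ℝ → EuclideanSpace ℝ (Fin 3) → EuclideanSpace ℝ (Fin 3)),
      1 < cmin ∧ 0 < δ ∧ Tendsto ε atTop (𝓝 0) ∧
        ∀ n, AngularLadder.IsWindowProfile (L n) C₀ cmin cmax δ (ε n) (c n) (R n) (u n) (p n)
          (d n) :=
  fun hwin => not_typeIDSSLiouvilleConjecture_of_windows hwin hW

/-- **The two open cruxes refute the wall.** K1 `RungBlowupCofinal` and K2 `NoOverheating` together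
refute the Type-I rotated-DSS Liouville conjecture — KJ-17's
`not_typeIDSSLiouvilleConjecture_of_ladder` with its K3 hypothesis discharged by the tree theorem.
[cite: BradshawTsai2017CPDE, §5 Open Problem 5.1] -/
theorem not_typeIDSSLiouvilleConjecture_of_cofinal_of_noOverheating (h₁ : RungBlowupCofinal)
    (h₂ : NoOverheating) : ¬ TypeIDSSLiouvilleConjecture :=
  not_typeIDSSLiouvilleConjecture_of_ladder h₁ h₂ Theorems.angularGalerkinLadder_limitTransfer

/-- **Refutation price of K2 `NoOverheating` (item 19960) after the closure of K3**: in a Liouville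
world, cofinally many singular rungs FORCE overheating — the uniform window with vanishing defect
cannot exist. A refutation of K2 as typed therefore costs (Open Problem 5.1 affirmative) ∧ K1; no
cheaper road is known (no singular rung profile has been constructed, KJ-17/KJ-28).
[cite: BradshawTsai2017CPDE, §5 Open Problem 5.1] -/
theorem noOverheating_false_of_typeIDSSLiouvilleConjecture_of_cofinal
    (hW : TypeIDSSLiouvilleConjecture) (h₁ : RungBlowupCofinal) : ¬ NoOverheating :=
  fun h₂ => not_typeIDSSLiouvilleConjecture_of_cofinal_of_noOverheating h₁ h₂ hW

/-- **Refutation price of K1 `RungBlowupCofinal` (item 19959) by this road**: in a Liouville world,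
the uniform window K2 forces the singular rungs to be eventually ABSENT. (The direct road to ¬K1 —
an eventual Liouville theorem for Type-I rotated-DSS ancient profiles of the truncated systems — is
not in print, KJ-17.) [cite: BradshawTsai2017CPDE, §5 Open Problem 5.1] -/
theorem rungBlowupCofinal_false_of_typeIDSSLiouvilleConjecture_of_noOverheating
    (hW : TypeIDSSLiouvilleConjecture) (h₂ : NoOverheating) : ¬ RungBlowupCofinal :=
  fun h₁ => not_typeIDSSLiouvilleConjecture_of_cofinal_of_noOverheating h₁ h₂ hW

/-- Census form: in a Liouville world the two open cruxes cannot hold together (which one fails is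
not decided here; K2 ⟸ ¬K1 vacuously, so in that world «K1 false, K2 true» is the consistent
assignment unless singular rungs are cofinal AND overheat). [cite: BradshawTsai2017CPDE, §5 Open Problem 5.1] -/
theorem not_cofinal_and_noOverheating_of_typeIDSSLiouvilleConjecture
    (hW : TypeIDSSLiouvilleConjecture) : ¬ (RungBlowupCofinal ∧ NoOverheating) :=
  fun h => not_typeIDSSLiouvilleConjecture_of_cofinal_of_noOverheating h.1 h.2 hW

/-- K2 is implied by the eventual absence of singular rungs (vacuity direction, refuter4 K85 (iii) /
tribunal T1 `noOverheating_of_not_cofinal`, here in the tree; stated with a double negation because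
this lane asserts no route statement positively): if singular rungs are NOT cofinal, `NoOverheating`
cannot fail — it holds with any admissible constants, e.g. `C₀ = 0`, `cmin = cmax = 2`, `δ = 1`,
`ε ≡ 0`. Hence in a Liouville world the consistent assignment is «K1 false, K2 (vacuously) true»
unless singular rungs are cofinal. [folklore] -/
theorem not_not_noOverheating_of_not_cofinal (h : ¬ RungBlowupCofinal) : ¬ ¬ NoOverheating := by
  intro hK2
  apply hK2
  simp only [RungBlowupCofinal, not_forall, not_exists, not_and] at h
  obtain ⟨L₀, hL₀⟩ := h
  unfold NoOverheating
  exact ⟨0, 2, 2, 1, L₀, fun _ => 0, by norm_num, by norm_num, tendsto_const_nhds,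
    fun L hL hs => absurd hs (hL₀ L hL)⟩

/-- The same dichotomy read on K1: in a Liouville world, EITHER singular rungs are eventually absent
(¬K1, and then K2 holds vacuously) OR they are cofinal and overheat (K1 ∧ ¬K2). [cite: BradshawTsai2017CPDE, §5 Open Problem 5.1] -/
theorem not_cofinal_or_overheating_of_typeIDSSLiouvilleConjecture
    (hW : TypeIDSSLiouvilleConjecture) :
    ¬ RungBlowupCofinal ∨ (RungBlowupCofinal ∧ ¬ NoOverheating) := by
  by_cases h₁ : RungBlowupCofinal
  · exact Or.inr ⟨h₁, noOverheating_false_of_typeIDSSLiouvilleConjecture_of_cofinal hW h₁⟩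
  · exact Or.inl h₁

end Summit.NavierStokesRegularity.AngularGalerkinLadderWallPriceAfterK3
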